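import Literature.AlgebraicGeometry.Frobenioids.PadicFrobenioidRelCosetBase
import HarnessLib

/-!
# Frobenioids II, Thm. 2.4 setting p. 19: "`Ψ_Base` … an outer isomorphism `Π₁ ⥲ Π₂` that lies over `G₁ ⥲ G₂`" implies
# that `Ψ` respects `Ker(Aut_C(A) → Aut_E(A_E))` (the input `hbase` of Theorem 2.4 (i) over general §2 bases, DISCHARGED
# from the printed structural hypothesis)

Mochizuki, *The geometry of Frobenioids II*, Kyushu J. Math. **62** (2008) 401–460, §2, Theorem 2.4 p. 19
[cite: MochizukiFrdII2008, Thm 2.4 (i) p.19]: "an equivalence of categories `Ψ : C₁ ⥲ C₂` — which … necessarily induces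
a 1-compatible equivalence of categories `Ψ_Base : D₁ ⥲ D₂`, hence an outer isomorphism of topological groups `Π₁ ⥲ Π₂`
[cf. [Mzk2], Proposition 3.2; [Mzk2], Theorem A.4] that lies over an outer isomorphism of topological groups `G₁ ⥲ G₂`
[cf. Theorem 1.2, (ii)]"; Definition 2.2 (i) p. 17 [cite: MochizukiFrdII2008, Def 2.2 (i) p.17]:
"`G_A := Aut_C(A)/(Ker(Aut_C(A) → Aut_E(A_E)))` induced by the functor `C → E`".

PROOF-ONLY file (seat abc-iut-L1-t7, gen 5; successor residual "general `Π ≠ G_{ℚ_p}` base chart" of GAP row G-L1t7-α;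
companion of `PadicKummerThm24iFrobenioidRel.lean`, whose Theorem 2.4 (i) over general bases `B^temp(Πᵢ, Πᵢ°)⁰` takes
the input `hbase` — "`Base(α⁻¹)` is trivial on `(A₁)_E` iff `Base((Ψα)⁻¹)` is trivial on `(Ψ A₁)_E`" — in kernel form).
Here `hbase` is DERIVED from the printed structural data, in the shape the small models carry it:
* `θ : Π₁ → Π₂` an open homomorphism "lying over" the `G`'s — `θ` carries `Ker(Π₁ → G_{ℚ_{p₁}})` exactly onto
  `Ker(Π₂ → G_{ℚ_{p₂}})` on its image (`hkerθ : φ₁ x = 1 ↔ φ₂ (θ x) = 1`, i.e. `φ₂ ∘ θ = g ∘ φ₁` for an injective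
  `g : G₁ → G₂`);
* "`Ψ_Base` is `θ_*` at `A₁`, 1-compatibly": an isomorphism `e : θ_*((A₁)_D) ≅ (Ψ A₁)_D` in `B^temp(Π₂)⁰` (small model
  `CosetCat Π₂`, push-forward `θ_*` = abc-iut-L5-t2's `CosetCat.push`) conjugating `Base(Ψα)` to `θ_*(Base α)` for every
  `α ∈ Aut_{C₁}(A₁)` (`compat`).
Tools: `CosetCat.push_map_eq_id_iff` (an endomorphism `h` of `Π/V`, `h(1·V) = π·V`, pushes forward to the identity along
`aug` iff `aug π ∈ aug(V)`). Pure (topological-)group/category plumbing; nothing here concerns [IUTchIII]; no statement of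
the paper is strengthened (the anabelian step "[Mzk2] Prop. 3.2" producing `θ` from `Ψ_Base` is NOT formalised here —
`θ`, `e`, `compat` remain named inputs, now in print's own shape).
-/

namespace Literature.AnabelianGeometry.SemiGraphs

namespace CosetCat

open CategoryTheory

universe u

variable {P : Type u} [Group P] [TopologicalSpace P] {G : Type u} [Group G] [TopologicalSpace G]
  (aug : P →* G) (ho : IsOpenMap aug)

/-- **An endomorphism `h` of `Π/V` with `h(1·V) = π·V` pushes forward to the identity of `G/aug(V)` iff `aug π ∈ aug(V)`.**
[cite: MochizukiFrdII2008, Def 2.2 (i) p.17] -/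
theorem push_map_eq_id_iff {X : CosetCat P} (h : X ⟶ X) (π : P) (hπ : (π : X.carrier) = pt h) :
    (push aug ho).map h = 𝟙 _ ↔ aug π ∈ mapOpen aug ho X.sg := by
  have hpt : pt ((push aug ho).map h) = ((aug π : G) : ((push aug ho).obj X).carrier) := by
    rw [pt_push_map, ← hπ, pushQuot_coe]
  constructor
  · intro h1
    have h2 := congrArg pt h1
    rw [hpt, pt_id, QuotientGroup.eq, mul_one, inv_mem_iff] at h2
    exact h2
  · intro h1
    apply hom_ext
    rw [hpt, pt_id, QuotientGroup.eq, mul_one, inv_mem_iff]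
    exact h1

omit [TopologicalSpace P] [TopologicalSpace G] in
/-- Conjugating an endomorphism by an isomorphism does not change whether a functor maps it to the identity.
[cite: MochizukiFrdII2008, Def 2.2 (i) p.17] -/
theorem functor_map_conj_eq_id_iff {C D : Type*} [Category C] [Category D] (F : C ⥤ D) {X Y : C} (e : X ≅ Y)
    (k : X ⟶ X) : F.map (e.inv ≫ k ≫ e.hom) = 𝟙 _ ↔ F.map k = 𝟙 _ := by
  rw [F.map_comp, F.map_comp]
  constructor
  · intro h
    have h2 : F.map e.hom ≫ (F.map e.inv ≫ F.map k ≫ F.map e.hom) ≫ F.map e.inv = F.map e.hom ≫ 𝟙 _ ≫ F.map e.inv := by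
      rw [h]
    simpa only [Category.assoc, Category.id_comp, ← F.map_comp, e.hom_inv_id, F.map_id, Category.comp_id,
      e.hom_inv_id_assoc] using h2
  · intro h
    rw [h, Category.id_comp, ← F.map_comp, e.inv_hom_id, F.map_id]

end CosetCat

end Literature.AnabelianGeometry.SemiGraphs

namespace Literature.AlgebraicGeometry.Frobenioids

namespace PadicFrd

namespace RelGal

open CategoryTheory Literature.AnabelianGeometry.SemiGraphs QuasiTemperoid

variable {p₁ p₂ : ℕ} [Fact p₁.Prime] [Fact p₂.Prime]
  {P₁ : Type} [Group P₁] [TopologicalSpace P₁] (φ₁ : P₁ →* GalFbar ℚ_[p₁]) (hφ₁ : IsOpenHom φ₁) {P₁₀ : OpenSubgroup P₁}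
  {P₂ : Type} [Group P₂] [TopologicalSpace P₂] (φ₂ : P₂ →* GalFbar ℚ_[p₂]) (hφ₂ : IsOpenHom φ₂) {P₂₀ : OpenSubgroup P₂}
  {d₁ : Datum (RelCosetCat P₁₀) p₁} {d₂ : Datum (RelCosetCat P₂₀) p₂}
  (F : d₁.frobenioid ⥤ d₂.frobenioid) {A₁ : d₁.frobenioid}
  (θ : P₁ →* P₂) (hθ : IsOpenMap θ) (hkerθ : ∀ x : P₁, φ₁ x = 1 ↔ φ₂ (θ x) = 1)
  (e : (CosetCat.push θ hθ).obj A₁.base.obj ≅ (F.obj A₁).base.obj)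
  (compat : ∀ α : Aut A₁, (ModelFrobenioid.baseMap (F.mapIso α).inv).hom =
    e.inv ≫ (CosetCat.push θ hθ).map (ModelFrobenioid.baseMap α.inv).hom ≫ e.hom)

include hkerθ in
/-- Under "`θ` lies over the `G`'s" (`hkerθ`): `φ₂(θ π) ∈ φ₂(θ(V))` iff `φ₁ π ∈ φ₁(V)`.
[cite: MochizukiFrdII2008, Thm 2.4 (i) p.19] -/
theorem map_theta_mem_mapOpen_iff (V : OpenSubgroup P₁) (π : P₁) :
    φ₂ (θ π) ∈ CosetCat.mapOpen φ₂ hφ₂.isOpenMap (CosetCat.mapOpen θ hθ V) ↔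
      φ₁ π ∈ CosetCat.mapOpen φ₁ hφ₁.isOpenMap V := by
  rw [CosetCat.mem_mapOpen, CosetCat.mem_mapOpen]
  constructor
  · rintro ⟨w, hw, hwπ⟩
    obtain ⟨v, hv, rfl⟩ := (CosetCat.mem_mapOpen θ hθ).mp hw
    refine ⟨v, hv, ?_⟩
    have h1 : φ₂ (θ (v⁻¹ * π)) = 1 := by rw [map_mul, map_mul, map_inv, map_inv, hwπ, inv_mul_cancel]
    have h2 : φ₁ (v⁻¹ * π) = 1 := (hkerθ _).mpr h1
    rwa [map_mul, map_inv, inv_mul_eq_one] at h2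
  · rintro ⟨v, hv, hvπ⟩
    refine ⟨θ v, (CosetCat.mem_mapOpen θ hθ).mpr ⟨v, hv, rfl⟩, ?_⟩
    have h2 : φ₁ (v⁻¹ * π) = 1 := by rw [map_mul, map_inv, hvπ, inv_mul_cancel]
    have h1 : φ₂ (θ (v⁻¹ * π)) = 1 := (hkerθ _).mp h2
    rwa [map_mul, map_mul, map_inv, map_inv, inv_mul_eq_one] at h1

include hkerθ compat in
/-- **"`Ψ_Base` = `θ_*` with `θ : Π₁ ⥲ Π₂` over `G₁ ⥲ G₂`" ⇒ `hbase`.** If `θ` carries `Ker(Π₁ → G_{ℚ_{p₁}})` onto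
`Ker(Π₂ → G_{ℚ_{p₂}})` on its image and `Base(Ψα)` is `θ_*(Base α)` up to the 1-compatibility isomorphism
`e : θ_*((A₁)_D) ≅ (Ψ A₁)_D`, then `Base(α⁻¹)` is trivial on `(A₁)_E` iff `Base((Ψα)⁻¹)` is trivial on `(Ψ A₁)_E` — the
input `hbase` of `PadicKummer.Def22Context.thm24i_ofFunctorRel`. [cite: MochizukiFrdII2008, Thm 2.4 (i) p.19] -/
theorem hbase_of_pushCompat (α : Aut A₁) :
    (CosetCat.push φ₁ hφ₁.isOpenMap).map (ModelFrobenioid.baseMap α.inv).hom = 𝟙 _ ↔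
      (CosetCat.push φ₂ hφ₂.isOpenMap).map (ModelFrobenioid.baseMap (F.mapIso α).inv).hom = 𝟙 _ := by
  obtain ⟨π, hπ⟩ := QuotientGroup.mk_surjective (CosetCat.pt (ModelFrobenioid.baseMap α.inv).hom)
  have hθπ : ((θ π : P₂) : ((CosetCat.push θ hθ).obj A₁.base.obj).carrier) =
      CosetCat.pt ((CosetCat.push θ hθ).map (ModelFrobenioid.baseMap α.inv).hom) := by
    rw [CosetCat.pt_push_map, ← hπ, CosetCat.pushQuot_coe]
  rw [compat α, CosetCat.functor_map_conj_eq_id_iff,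
    CosetCat.push_map_eq_id_iff φ₂ hφ₂.isOpenMap _ (θ π) hθπ,
    CosetCat.push_map_eq_id_iff φ₁ hφ₁.isOpenMap _ π hπ]
  exact (map_theta_mem_mapOpen_iff φ₁ hφ₁ φ₂ hφ₂ θ hθ hkerθ A₁.base.obj.sg π).symm

end RelGal

end PadicFrd

end Literature.AlgebraicGeometry.Frobenioids
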